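/-
Chen 2024 (IACR ePrint 2024/555, version of 2024-04-18), §3.5.5 pp. 26–27: Step 5 (split `|h⟩ = |h′⟩|h″⟩`
into high and low digits, `h = h′·(t²+u²) + h″`, `P = M·(t²+u²)` by Cond. C.2 p. 18, and measure `h″ = h*`)
EXACTLY, for the untruncated states: starting from the printed eq. (24) (`phi4_eq24` of
`ChenQuantumLWEStepFour`), the `j`-series FACTORISES after the digit split (the paper's remark on eq. (25),
p. 27) and the residual state is eq. (26) with its two dropped global constants made explicit.  Pure
algebra on top of (24): the integrality `e^{2πi·j(⟨x,h̃′⟩ + M⟨x,m⟩)} = 1` and the exact cancellation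
`⟨x, (⟨x,y⟩/‖x‖²)x − y⟩ = 0`.

REPRODUCTION / ANALYSIS OF A CLAIMED RESULT UNDER ADJUDICATION (withdrawn by its author, note of 2024-04-18).
HONEST FRAMING: the VALUE is a THEOREM / DECIDABLE VERDICT / CERTIFICATE / precise negative result — NOT
summit progress.  Theorems about a WITHDRAWN algorithm: they certify that eq. (26) is CORRECT as an exact
identity for the untruncated states and for EVERY measurement outcome `h*` (the defect of the paper is
elsewhere: the periodicity premise of Lemma 2.17 in Step 9, `ChenQuantumLWESteps`); nothing is repaired,
nothing is broken, no cryptanalytic claim.  The probability statement of Step 5 (Lemma 3.24: the outcome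
`h*` is well placed with probability `1 − 2^{−Ω(n)}`) and all `≈` truncations are NOT treated.
No named fact is introduced (debt 0).
-/
import Literature.Computability.Cryptography.ChenQuantumLWEStepFour

/-!
# Chen 2024, Step 5: the digit split and the measurement of `h″` (eq. (25)–(26)) — exactly

Setting (§3.5.5, p. 26–27).  With the correct guess `u² = ‖x‖²` put `N := t² + ‖x‖²`; Cond. C.2 (p. 18)
chooses `P = M·N`.  The register `|h⟩`, `h ∈ ℤ_Pⁿ`, of `|φ₄⟩` (eq. (24), `phi4`, `phi4_eq24`) is read as
`|h′⟩|h″⟩` through `h = h′·N + h″`, `h′ ∈ ℤ_Mⁿ` (high digits), `h″ ∈ ℤ_Nⁿ` (low digits) — the digit join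
`digitJoin`/`joinVec`, a bijection `ℤ_M × ℤ_N → ℤ_P` (`digitJoin_bijective`).  The low register is
measured with outcome `h*`; the residual (unnormalised) state is the slice `|φ₅⟩(h′) = |φ₄⟩(h′·N + h*)`
(`phi5`).

Results (all exact, all constants explicit; `h̃′ ∈ [0,M)ⁿ`, `h̃* ∈ [0,N)ⁿ` the representatives):
* `add_wShift_joinVec` — the argument of (24) after the split: `m + (h̃ + (⟨x,y⟩/‖x‖²)x − y)/P = w′/M`,
  `w′ = h̃′ + (Pm + h̃* + (⟨x,y⟩/‖x‖²)x − y)/N` (`wPrime`; eq. (26) writes `m ∈ Pℤⁿ` for our `Pm`).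
* `step5_phase` — the remark on eq. (25) (p. 27): `e^{−2πi⟨d_j, w′/M⟩} = e^{−2πi⟨d′,w′⟩/M}·e^{2πij⟨x,h̃*⟩/N}`
  with `d′ = z′ − x⟨x,z′⟩/N` (`dPrime`), because `(Pj/N)·⟨x, w′⟩/M = j⟨x,h̃′⟩ + jM⟨x,m⟩ + j⟨x,h̃*⟩/N`
  ("since `h′ + m/(t²+‖x‖²) ∈ ℤⁿ, x ∈ ℤⁿ, j ∈ ℤ`") — the centre terms cancel exactly (`sum_x_mul_wPrime`).
* `step5_term` — hence every `m`-term of (24) is `K(h*) ·` (Gaussian of (26) at `w′`) `·` (phase of (26)),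
  `K(h*) = Σ_{j∈ℤ} e^{2πij(⟨x,h̃*⟩/N − ⟨x,y⟩/‖x‖²)} e^{−(π/(P²‖x‖²a))C_j}` (`step5Const`) depending on the
  outcome only ("completely independent of `h′, m`").
* `phi5_eq26` (T3) — eq. (26) as printed: `|φ₅⟩(h′) = C · K(h*) · Σ_{m∈ℤⁿ} exp(−π N²‖x‖²a · w′ᵀΣw′) ·
  e^{−2πi⟨d′, w′⟩/M}` (`N²‖x‖²a = (t²+‖x‖²)²‖x‖²(s²+r²i)/(s²r²)`, `Σ` of (23)), `C` the constant of (24).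
  The printed phase `e(−⟨d′, (h′ + (m+h*)/(t²+‖x‖²))/M⟩)` omits the `(h′,m)`-free part
  `⟨d′, ((⟨x,y⟩/‖x‖²)x − y)/N⟩/M` of `⟨d′,w′⟩/M` — one more global phase under the paper's `∝`.

[cite: ChenQuantumLattice2024, §3.5.5, eq. (25)–(26), p. 26–27; Cond. C.2 p. 18]
-/

namespace Literature.Computability.Cryptography.Chen2024

open scoped BigOperators Real
open Complex hiding exp continuous_exp exp_add

noncomputable section

section StepFive

variable {n : ℕ}

/-- The digit join `(h′, h″) ↦ h = h′·N + h″` of Step 5 (`h′` the high digits in `ℤ_M`, `h″` the low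
digits in `ℤ_N`, `N = t² + u²`, `P = M·N` by Cond. C.2), read in `ℤ_P` through the representatives
in `[0,M)` and `[0,N)`. [cite: ChenQuantumLattice2024, §3.5.5 p. 26] -/
def digitJoin (P N : ℕ) {M : ℕ} (h' : ZMod M) (hs : ZMod N) : ZMod P :=
  ((h'.val * N + hs.val : ℕ) : ZMod P)

/-- The representative of the joined digit is `h̃′·N + h̃″ < M·N = P`.
[cite: ChenQuantumLattice2024, §3.5.5 p. 26] -/
theorem digitJoin_val {P M N : ℕ} [NeZero M] [NeZero N] (hP : P = M * N) (h' : ZMod M)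
    (hs : ZMod N) : (digitJoin P N h' hs).val = h'.val * N + hs.val := by
  unfold digitJoin
  rw [ZMod.val_natCast, Nat.mod_eq_of_lt]
  have h1 : h'.val < M := ZMod.val_lt h'
  have h2 : hs.val < N := ZMod.val_lt hs
  calc h'.val * N + hs.val < h'.val * N + N := by omega
    _ = (h'.val + 1) * N := by ring
    _ ≤ M * N := Nat.mul_le_mul_right _ h1
    _ = P := hP.symm

/-- The digit join is a bijection `ℤ_M × ℤ_N → ℤ_P` (`P = M·N`): splitting the register `|h⟩` into
`|h′⟩|h″⟩` is a relabelling of the computational basis. [cite: ChenQuantumLattice2024, §3.5.5 p. 26] -/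
theorem digitJoin_bijective {P M N : ℕ} [NeZero M] [NeZero N] [NeZero P] (hP : P = M * N) :
    Function.Bijective (fun p : ZMod M × ZMod N => digitJoin P N p.1 p.2) := by
  rw [Fintype.bijective_iff_injective_and_card]
  refine ⟨?_, by simp [ZMod.card, hP]⟩
  have hN : 0 < N := Nat.pos_of_ne_zero (NeZero.ne N)
  have e1 : ∀ (u : ZMod M) (v : ZMod N), (u.val * N + v.val) % N = v.val := fun u v => by
    rw [add_comm, Nat.add_mul_mod_self_right, Nat.mod_eq_of_lt (ZMod.val_lt v)]
  have e2 : ∀ (u : ZMod M) (v : ZMod N), (u.val * N + v.val) / N = u.val := fun u v => by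
    rw [add_comm, Nat.add_mul_div_right _ _ hN, Nat.div_eq_of_lt (ZMod.val_lt v), zero_add]
  rintro ⟨a, b⟩ ⟨c, d⟩ h
  have hv : a.val * N + b.val = c.val * N + d.val := by
    have := congrArg ZMod.val h
    simpa only [digitJoin_val hP] using this
  have hbd : b.val = d.val := by rw [← e1 a b, hv, e1 c d]
  have hac : a.val = c.val := by rw [← e2 a b, hv, e2 c d]
  simp only [Prod.mk.injEq]
  exact ⟨ZMod.val_injective _ hac, ZMod.val_injective _ hbd⟩

/-- Coordinatewise digit join on the `n`-register `|h⟩ = |h′⟩|h″⟩`.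
[cite: ChenQuantumLattice2024, §3.5.5 p. 26] -/
def joinVec (P N : ℕ) {M : ℕ} (h' : Fin n → ZMod M) (hs : Fin n → ZMod N) : Fin n → ZMod P :=
  fun i => digitJoin P N (h' i) (hs i)

/-- The (unnormalised) residual state `|φ₅⟩` of Step 5: the amplitudes of `|φ₄⟩` on the slice where the
low-digit register reads the measured `h* ∈ ℤ_Nⁿ`, as a function of the high digits `h′ ∈ ℤ_Mⁿ`.
[cite: ChenQuantumLattice2024, §3.5.5 eq. (25)–(26) p. 26–27] -/
def phi5 (P N : ℕ) [NeZero P] {M : ℕ} (a b : ℂ) (x y z' : Fin n → ℤ) (hs : Fin n → ZMod N) :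
    (Fin n → ZMod M) → ℂ :=
  fun h' => phi4 P a b x y z' (joinVec P N h' hs)

/-- The shift `w′ = h′ + m/N + (h* + (⟨x,y⟩/‖x‖²)x − y)/N` of eq. (26), with `m ∈ Pℤⁿ` written `P·m`,
`m ∈ ℤⁿ` (`h̃′ ∈ [0,M)ⁿ`, `h̃* ∈ [0,N)ⁿ` the representatives).
[cite: ChenQuantumLattice2024, eq. (26) p. 27] -/
def wPrime (P N : ℕ) {M : ℕ} (x y : Fin n → ℤ) (h' : Fin n → ZMod M) (hs : Fin n → ZMod N)
    (m : Fin n → ℤ) : Fin n → ℂ :=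
  fun i => (((h' i).val : ℕ) : ℂ) + ((P : ℂ) * (m i : ℂ) + (((hs i).val : ℕ) : ℂ)
    + ((x ⬝ᵥ y : ℤ) : ℂ) / ((x ⬝ᵥ x : ℤ) : ℂ) * (x i : ℂ) - (y i : ℂ)) / (N : ℂ)

/-- The `j`-free direction `d′ = z′ − x⟨x,z′⟩/(t²+‖x‖²)` of eq. (26) (`N = t² + ‖x‖²`).
[cite: ChenQuantumLattice2024, eq. (26) p. 27] -/
def dPrime (N : ℕ) (x z' : Fin n → ℤ) : Fin n → ℂ :=
  fun i => (z' i : ℂ) - ((x ⬝ᵥ z' : ℤ) : ℂ) / (N : ℂ) * (x i : ℂ)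

/-- The global constant of Step 5: the `j`-series of (24) after the measurement, which depends on the
outcome `h*` only (p. 27: "the term `Σ_{j∈ℤ} …` in Eqn. (25) is completely independent of `h′` and
`m`"). [cite: ChenQuantumLattice2024, §3.5.5 p. 27] -/
def step5Const (P N : ℕ) (a : ℂ) (t : ℝ) (x y z' : Fin n → ℤ) (hs : Fin n → ZMod N) : ℂ :=
  ∑' j : ℤ, cexp (2 * π * I * j * ((∑ i, (x i : ℂ) * (((hs i).val : ℕ) : ℂ)) / (N : ℂ)
      - ((x ⬝ᵥ y : ℤ) : ℂ) / ((x ⬝ᵥ x : ℤ) : ℂ)))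
    * cexp (-π / ((P : ℂ) ^ 2 * ((x ⬝ᵥ x : ℤ) : ℂ) * a) * cTerm P t x z' j)

/-- `vᵀΣv` is a quadratic form: `σ(v/M) = σ(v)/M²`. [folklore] -/
theorem sigmaForm_div_const (t : ℝ) (x : Fin n → ℤ) (v : Fin n → ℂ) (c : ℂ) :
    sigmaForm t x (fun i => v i / c) = sigmaForm t x v / c ^ 2 := by
  simp only [sigmaForm, div_pow, ← Finset.sum_div]
  have e : ∑ i, (x i : ℂ) * (v i / c) = (∑ i, (x i : ℂ) * v i) / c := by
    rw [Finset.sum_div]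
    exact Finset.sum_congr rfl fun i _ => by ring
  rw [e]
  ring

/-- After the digit split `h̃ = h̃′N + h̃*` the argument `m + h̃/P + ⟨x,y⟩x/(‖x‖²P) − y/P` of (24) is
`w′/M`. [cite: ChenQuantumLattice2024, §3.5.5 p. 26–27] -/
theorem add_wShift_joinVec {P M N : ℕ} [NeZero M] [NeZero N] (hP : P = M * N)
    (x y : Fin n → ℤ) (h' : Fin n → ZMod M) (hs : Fin n → ZMod N) (m : Fin n → ℤ) (i : Fin n) :
    (m i : ℂ) + wShift P x y (joinVec P N h' hs) i = wPrime P N x y h' hs m i / (M : ℂ) := by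
  have hM : (M : ℂ) ≠ 0 := by exact_mod_cast NeZero.ne M
  have hN : (N : ℂ) ≠ 0 := by exact_mod_cast NeZero.ne N
  have hPc : (P : ℂ) = (M : ℂ) * (N : ℂ) := by rw [hP]; push_cast; ring
  simp only [wShift, wPrime, joinVec, digitJoin_val hP]
  rw [hPc]
  push_cast
  field_simp
  ring

/-- `d_j = d′ − (Pj/N)·x` inside the pairing of (24): `⟨d_j, v⟩ = ⟨d′, v⟩ − (Pj/N)⟨x, v⟩` (`N = t²+‖x‖²`).
[cite: ChenQuantumLattice2024, §3.5.5 p. 27] -/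
theorem sum_dVec_mul {P N : ℕ} {t : ℝ} {x : Fin n → ℤ}
    (htN : (t : ℂ) ^ 2 + ((x ⬝ᵥ x : ℤ) : ℂ) = (N : ℂ)) (z' : Fin n → ℤ) (j : ℤ) (v : Fin n → ℂ) :
    ∑ i, dVec P t x z' j i * v i
      = ∑ i, dPrime N x z' i * v i - (P : ℂ) * j / (N : ℂ) * ∑ i, (x i : ℂ) * v i := by
  have e : ∀ i, dVec P t x z' j i * v i
      = dPrime N x z' i * v i - (P : ℂ) * j / (N : ℂ) * ((x i : ℂ) * v i) := by
    intro i
    simp only [dVec, dPrime, htN]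
    ring
  simp only [e, Finset.sum_sub_distrib, ← Finset.mul_sum]

/-- `⟨x, w′⟩ = ⟨x, h̃′⟩ + (P⟨x,m⟩ + ⟨x,h̃*⟩)/N`: the centre terms cancel because `⟨x, (⟨x,y⟩/‖x‖²)x − y⟩ = 0`.
[cite: ChenQuantumLattice2024, §3.5.5 p. 27] -/
theorem sum_x_mul_wPrime {P M N : ℕ} {x : Fin n → ℤ} (hx : x ≠ 0) (y : Fin n → ℤ)
    (h' : Fin n → ZMod M) (hs : Fin n → ZMod N) (m : Fin n → ℤ) :
    ∑ i, (x i : ℂ) * wPrime P N x y h' hs m i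
      = ∑ i, (x i : ℂ) * (((h' i).val : ℕ) : ℂ)
        + ((P : ℂ) * ∑ i, (x i : ℂ) * (m i : ℂ) + ∑ i, (x i : ℂ) * (((hs i).val : ℕ) : ℂ)) / (N : ℂ) := by
  have hX : ((x ⬝ᵥ x : ℤ) : ℂ) ≠ 0 := by exact_mod_cast (dotProduct_self_pos_int hx).ne'
  have hX1 : ∑ i, (x i : ℂ) * (x i : ℂ) = ((x ⬝ᵥ x : ℤ) : ℂ) := by
    rw [dotProduct]; push_cast; rfl
  have hXY : ∑ i, (x i : ℂ) * (y i : ℂ) = ((x ⬝ᵥ y : ℤ) : ℂ) := by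
    rw [dotProduct]; push_cast; rfl
  have e : ∀ i, (x i : ℂ) * wPrime P N x y h' hs m i
      = (x i : ℂ) * (((h' i).val : ℕ) : ℂ)
        + ((P : ℂ) * ((x i : ℂ) * (m i : ℂ)) + (x i : ℂ) * (((hs i).val : ℕ) : ℂ)) / (N : ℂ)
        + (((x ⬝ᵥ y : ℤ) : ℂ) / ((x ⬝ᵥ x : ℤ) : ℂ) * ((x i : ℂ) * (x i : ℂ))
            - (x i : ℂ) * (y i : ℂ)) / (N : ℂ) := by
    intro i
    simp only [wPrime]
    ring
  simp only [e, Finset.sum_add_distrib, Finset.sum_sub_distrib, ← Finset.sum_div, ← Finset.mul_sum,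
    hX1, hXY]
  rw [div_mul_cancel₀ _ hX, sub_self, zero_div, add_zero]


/-- The phase of (24) FACTORISES after the digit split (p. 27): with `h̃ = h̃′N + h̃*` and `P = MN`,
`e^{−2πi⟨d_j, w′/M⟩} = e^{−2πi⟨d′, w′⟩/M} · e^{2πi j⟨x,h̃*⟩/N}` — the factor that drops out is
`e^{2πi·j(⟨x,h̃′⟩ + M⟨x,m⟩)} = 1` ("since `h′ + m/(t²+‖x‖²) ∈ ℤⁿ`, `x ∈ ℤⁿ`, `j ∈ ℤ`"), and the centre
terms cancel exactly (`⟨x, (⟨x,y⟩/‖x‖²)x − y⟩ = 0`). [cite: ChenQuantumLattice2024, §3.5.5 p. 27] -/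
theorem step5_phase {P M N : ℕ} [NeZero M] [NeZero N] (hP : P = M * N) {t : ℝ} {x : Fin n → ℤ}
    (hx : x ≠ 0) (htN : (t : ℂ) ^ 2 + ((x ⬝ᵥ x : ℤ) : ℂ) = (N : ℂ)) (y z' : Fin n → ℤ)
    (h' : Fin n → ZMod M) (hs : Fin n → ZMod N) (m : Fin n → ℤ) (j : ℤ) :
    cexp (-2 * π * I * ∑ i, dVec P t x z' j i * (wPrime P N x y h' hs m i / (M : ℂ)))
      = cexp (-2 * π * I * (∑ i, dPrime N x z' i * wPrime P N x y h' hs m i) / (M : ℂ))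
        * cexp (2 * π * I * j * ((∑ i, (x i : ℂ) * (((hs i).val : ℕ) : ℂ)) / (N : ℂ))) := by
  have hM : (M : ℂ) ≠ 0 := by exact_mod_cast NeZero.ne M
  have hN : (N : ℂ) ≠ 0 := by exact_mod_cast NeZero.ne N
  have hPc : (P : ℂ) = (M : ℂ) * (N : ℂ) := by rw [hP]; push_cast; ring
  rw [sum_dVec_mul htN]
  have e1 : ∑ i, dPrime N x z' i * (wPrime P N x y h' hs m i / (M : ℂ))
      = (∑ i, dPrime N x z' i * wPrime P N x y h' hs m i) / (M : ℂ) := by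
    rw [Finset.sum_div]
    exact Finset.sum_congr rfl fun i _ => by ring
  have e2 : ∑ i, (x i : ℂ) * (wPrime P N x y h' hs m i / (M : ℂ))
      = (∑ i, (x i : ℂ) * wPrime P N x y h' hs m i) / (M : ℂ) := by
    rw [Finset.sum_div]
    exact Finset.sum_congr rfl fun i _ => by ring
  rw [e1, e2, sum_x_mul_wPrime hx]
  -- the integer that drops out of the phase
  set Iz : ℤ := j * (∑ i, x i * ((h' i).val : ℤ) + (M : ℤ) * ∑ i, x i * m i) with hIz
  have hcast : ((Iz : ℤ) : ℂ) = (j : ℂ) * (∑ i, (x i : ℂ) * (((h' i).val : ℕ) : ℂ)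
      + (M : ℂ) * ∑ i, (x i : ℂ) * (m i : ℂ)) := by
    rw [hIz]
    push_cast
    ring
  have key : -2 * π * I * ((∑ i, dPrime N x z' i * wPrime P N x y h' hs m i) / (M : ℂ)
        - (P : ℂ) * j / (N : ℂ) * ((∑ i, (x i : ℂ) * (((h' i).val : ℕ) : ℂ)
          + ((P : ℂ) * ∑ i, (x i : ℂ) * (m i : ℂ) + ∑ i, (x i : ℂ) * (((hs i).val : ℕ) : ℂ)) / (N : ℂ))
            / (M : ℂ)))
      = (-2 * π * I * (∑ i, dPrime N x z' i * wPrime P N x y h' hs m i) / (M : ℂ)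
          + 2 * π * I * j * ((∑ i, (x i : ℂ) * (((hs i).val : ℕ) : ℂ)) / (N : ℂ)))
        + (Iz : ℂ) * (2 * π * I) := by
    rw [hcast, hPc]
    field_simp
    ring
  rw [key, Complex.exp_add, Complex.exp_int_mul_two_pi_mul_I, mul_one, Complex.exp_add]

/-- Step 5, one term of (24) after the measurement: for every `m ∈ ℤⁿ` the Gaussian factor becomes the
Gaussian of (26) at `w′` (rate `N²‖x‖²a = (t²+‖x‖²)²‖x‖²(s²+r²i)/(s²r²)`) and the `j`-series factorises
into the outcome-only constant `step5Const` times the phase `e^{−2πi⟨d′, w′⟩/M}`.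
[cite: ChenQuantumLattice2024, §3.5.5 eq. (25)–(26) p. 26–27] -/
theorem step5_term {P M N : ℕ} [NeZero M] [NeZero N] (hP : P = M * N) (a : ℂ)
    {t : ℝ} {x : Fin n → ℤ} (hx : x ≠ 0) (htN : (t : ℂ) ^ 2 + ((x ⬝ᵥ x : ℤ) : ℂ) = (N : ℂ))
    (y z' : Fin n → ℤ) (h' : Fin n → ZMod M) (hs : Fin n → ZMod N) (m : Fin n → ℤ) :
    cexp (-π * ((P : ℂ) ^ 2 * ((x ⬝ᵥ x : ℤ) : ℂ) * a)
          * sigmaForm t x (fun i => (m i : ℂ) + wShift P x y (joinVec P N h' hs) i))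
        * ∑' j : ℤ, cexp (-2 * π * I * ∑ i, dVec P t x z' j i
              * ((m i : ℂ) + wShift P x y (joinVec P N h' hs) i))
            * cexp (-2 * π * I * (((x ⬝ᵥ y : ℤ) : ℂ) / ((x ⬝ᵥ x : ℤ) : ℂ)) * j)
            * cexp (-π / ((P : ℂ) ^ 2 * ((x ⬝ᵥ x : ℤ) : ℂ) * a) * cTerm P t x z' j)
      = step5Const P N a t x y z' hs
        * (cexp (-π * ((N : ℂ) ^ 2 * ((x ⬝ᵥ x : ℤ) : ℂ) * a) * sigmaForm t x (wPrime P N x y h' hs m))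
          * cexp (-2 * π * I * (∑ i, dPrime N x z' i * wPrime P N x y h' hs m i) / (M : ℂ))) := by
  have hM : (M : ℂ) ≠ 0 := by exact_mod_cast NeZero.ne M
  have hPc : (P : ℂ) = (M : ℂ) * (N : ℂ) := by rw [hP]; push_cast; ring
  simp_rw [add_wShift_joinVec hP x y h' hs m]
  -- the Gaussian factor
  have hE : cexp (-π * ((P : ℂ) ^ 2 * ((x ⬝ᵥ x : ℤ) : ℂ) * a)
        * sigmaForm t x (fun i => wPrime P N x y h' hs m i / (M : ℂ)))
      = cexp (-π * ((N : ℂ) ^ 2 * ((x ⬝ᵥ x : ℤ) : ℂ) * a)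
        * sigmaForm t x (wPrime P N x y h' hs m)) := by
    rw [sigmaForm_div_const, hPc]
    congr 1
    field_simp
  rw [hE]
  -- the phase factor, termwise, and the outcome-only constant
  simp_rw [step5_phase hP hx htN y z' h' hs m]
  have hk : ∀ j : ℤ,
      cexp (-2 * π * I * (∑ i, dPrime N x z' i * wPrime P N x y h' hs m i) / (M : ℂ))
        * cexp (2 * π * I * j * ((∑ i, (x i : ℂ) * (((hs i).val : ℕ) : ℂ)) / (N : ℂ)))
        * cexp (-2 * π * I * (((x ⬝ᵥ y : ℤ) : ℂ) / ((x ⬝ᵥ x : ℤ) : ℂ)) * j)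
        * cexp (-π / ((P : ℂ) ^ 2 * ((x ⬝ᵥ x : ℤ) : ℂ) * a) * cTerm P t x z' j)
      = cexp (-2 * π * I * (∑ i, dPrime N x z' i * wPrime P N x y h' hs m i) / (M : ℂ))
        * (cexp (2 * π * I * j * ((∑ i, (x i : ℂ) * (((hs i).val : ℕ) : ℂ)) / (N : ℂ)
              - ((x ⬝ᵥ y : ℤ) : ℂ) / ((x ⬝ᵥ x : ℤ) : ℂ)))
            * cexp (-π / ((P : ℂ) ^ 2 * ((x ⬝ᵥ x : ℤ) : ℂ) * a) * cTerm P t x z' j)) := by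
    intro j
    have e : cexp (2 * π * I * j * ((∑ i, (x i : ℂ) * (((hs i).val : ℕ) : ℂ)) / (N : ℂ)))
        * cexp (-2 * π * I * (((x ⬝ᵥ y : ℤ) : ℂ) / ((x ⬝ᵥ x : ℤ) : ℂ)) * j)
        = cexp (2 * π * I * j * ((∑ i, (x i : ℂ) * (((hs i).val : ℕ) : ℂ)) / (N : ℂ)
            - ((x ⬝ᵥ y : ℤ) : ℂ) / ((x ⬝ᵥ x : ℤ) : ℂ))) := by
      rw [← Complex.exp_add]
      congr 1
      ring
    rw [← e]
    ring
  simp_rw [hk]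
  rw [tsum_mul_left, step5Const]
  ring

/-- **Step 5 exactly (eq. (26)).**  Take the window rate `b = t²/(P²‖x‖²a)` of Step 3 with the correct
guess (`t² + ‖x‖² = N`, `P = M·N`, Cond. C.2 p. 18) and measure the low digits `h″ = h* ∈ ℤ_Nⁿ` of
`|φ₄⟩ = Σ_h |φ₄⟩(h)|h′⟩|h″⟩`.  The residual (unnormalised) state on the high digits is, for EVERY outcome
`h*` and every `h′ ∈ ℤ_Mⁿ`,
`|φ₅⟩(h′) = C · K(h*) · Σ_{m∈ℤⁿ} exp(−π N²‖x‖²a · w′ᵀΣw′) · e^{−2πi⟨z′ − x⟨x,z′⟩/N, w′⟩/M}`,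
`w′ = h̃′ + (Pm + h̃* + (⟨x,y⟩/‖x‖²)x − y)/N` — eq. (26) as printed (its `m ∈ Pℤⁿ` is our `Pm`; its
rate `(t²+‖x‖²)²‖x‖²(s²+r²i)/(s²r²) = N²‖x‖²a`; its phase `e(−⟨z′ − x⟨x,z′⟩/(t²+‖x‖²), (h′ +
(m+h*)/(t²+‖x‖²))/M⟩)` omits only the `(h′,m)`-free part `⟨d′, ((⟨x,y⟩/‖x‖²)x − y)/N⟩/M` of ours, a
global phase), with the two constants the paper drops made explicit: `C` of (24) (`phi4_eq24`) and the
outcome-only `j`-series `K(h*) = step5Const` (p. 27: "completely independent of `h′` and `m`").  The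
probability claim of Step 5 (Lemma 3.24) and the `≈` of (26) are NOT treated.
[cite: ChenQuantumLattice2024, §3.5.5 eq. (25)–(26) p. 26–27] -/
theorem phi5_eq26 {P M N : ℕ} [NeZero P] [NeZero M] [NeZero N] (hP : P = M * N) {a : ℂ}
    (ha : 0 < a.re) {x : Fin n → ℤ} (hx : x ≠ 0) (y z' : Fin n → ℤ) {t : ℝ} (ht : t ≠ 0)
    (htN : (t : ℂ) ^ 2 + ((x ⬝ᵥ x : ℤ) : ℂ) = (N : ℂ)) (hs : Fin n → ZMod N)
    (h' : Fin n → ZMod M) :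
    phi5 P N a ((t : ℂ) ^ 2 / ((P : ℂ) ^ 2 * ((x ⬝ᵥ x : ℤ) : ℂ) * a)) x y z' hs h'
      = cexp (-π * a * (((y ⬝ᵥ y : ℤ) : ℂ) - ((x ⬝ᵥ y : ℤ) : ℂ) ^ 2 / ((x ⬝ᵥ x : ℤ) : ℂ)))
        * (1 / ((t : ℂ) ^ 2 / ((P : ℂ) ^ 2 * ((x ⬝ᵥ x : ℤ) : ℂ) * a)) ^ (1 / 2 : ℂ)) ^ n
        * (1 / (a * ((x ⬝ᵥ x : ℤ) : ℂ) * ((t : ℂ) ^ 2 + ((x ⬝ᵥ x : ℤ) : ℂ)) / (t : ℂ) ^ 2)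
            ^ (1 / 2 : ℂ))
        * step5Const P N a t x y z' hs
        * ∑' m : Fin n → ℤ,
            cexp (-π * ((N : ℂ) ^ 2 * ((x ⬝ᵥ x : ℤ) : ℂ) * a) * sigmaForm t x (wPrime P N x y h' hs m))
            * cexp (-2 * π * I * (∑ i, dPrime N x z' i * wPrime P N x y h' hs m i) / (M : ℂ)) := by
  unfold phi5
  rw [phi4_eq24 ha hx y z' ht]
  simp_rw [step5_term hP a hx htN y z' h' hs]
  rw [tsum_mul_left]
  ring

end StepFive

end

end Literature.Computability.Cryptography.Chen2024
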